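import Literature.Probability.RandomPlanarGeometry.HexSAWSurfaceWallBridges
import Literature.Probability.RandomPlanarGeometry.HexSAWSurfaceYcLimit
import Literature.Probability.RandomPlanarGeometry.HexSAWLowerBound
import HarnessLib

/-!
# Honeycomb SAW at a surface, brick-wall frame, II: the limit `μ(y) = lim_n C_n(y)^{1/n}` exists for EVERY `y > 0`

Topic `Literature/Probability/RandomPlanarGeometry` (lane pcv-sawmu, door S1 «HEX-YC-LIMIT-ALL-Y»).  Part I
(`HexSAWSurfaceWallBridges.lean`) works in the brick-wall model with the surface the row `Y = 0`: half-plane walks `hpw m`,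
their weights `C^w_m(y) = Cw m y`, the wall-bridge growth rate `β(y) = wallRate y`, and the two-sided estimate
`c·rᵐ ≤ C^w_m(y)` (`r < β`) / `C^w_m(y) ≤ rᵐ` (`r > max(β, μ)`) eventually.  This file identifies these with the
Duminil-Copin–Smirnov-frame weights `C_n(y) = hpCoeff n y` of `HexSAWSurfaceYcGrowth.lean` (mid-edge walks from `a`, `n` visited
vertices in the upper half-plane `{lev ≥ 0}`, weight `y^{#surface vertices}`) and concludes.

* THE CHART `ch : ℍ ≃g brick wall`, `(a, b, t) ↦ (2a + b + [t], -b)`: `O ↦ 0`, `{lev ≥ 0} = {Y ≤ 0}`, surface row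
  `{lev = 0} = {Y = 0, X even}`; along a walk from `O` the vertex visited at time `i` is on the surface iff `Y_i = 0` and `i` is
  even (`HexBW.parity_apply`), which is Part I's notion of a visit.
* THE DICTIONARY: a mid-edge walk `γ = w :: (l ++ [u])` with `n = m + 1` visited vertices `l = [O = v₀, …, v_m]` is sent to the
  `m`-step wall walk `ch ∘ l`; the map is onto `hpw m`, at most `3`-to-one (the exit vertex `u` is a neighbour of `v_m`), and
  `#contacts(γ) = 1 + visits`.  Hence **`y · C^w_m(y) ≤ C_{m+1}(y) ≤ 3y · C^w_m(y)`** (`mul_Cw_le_hpCoeff_succ`, `hpCoeff_succ_le`).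
* THE LIMIT: with **`surfaceMu y := max (wallRate y) μ`**, `GrowthGeRate y (surfaceMu y)` (Part I below `β`, T5's
  `growthGeRate_mu_of_pos` below `μ`) and `∀ r > surfaceMu y, ∀ᶠ n, C_n(y) ≤ rⁿ`; the squeeze of `HexSAWSurfaceYcLimit` then gives
  **`tendsto_hpCoeff_rpow : 0 < y → C_n(y)^{1/n} → surfaceMu y`** — BBdGDCG14 Proposition 5, first sentence ("For y > 0,
  μ(y) := lim_{k→∞} C_k^+(y)^{1/k} exists and is finite."), for the honeycomb lattice, unconditionally and for every `y > 0`.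
  The printed proof is by reference ("[HTW82] … apply mutatis mutandis to the honeycomb lattice"); the lattice-specific point
  made explicit here is Part I's transpose-free two-sided unfolding `G` on the brick wall (the honeycomb has the reflections
  `X ↦ 2c - X` but not the transpose of `ℤ²`); the printed honeycomb adaptation closest to it is Beaton's rotated-frame one
  (Beaton 2014, Prop. 7 and eqs. (16)–(19)).  Corollaries: `surfaceMu y = μ ↔ y ≤ 1 + √2` (with T5's
  `tendsto_hpCoeff_rpow_iff`), `μ < wallRate y ↔ 1 + √2 < y`.  The IDENTIFICATION of the limit as `max(β(y), μ)` with `β(y)` the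
  wall-bridge rate is not printed in BBdGDCG14 (which prints existence and `μ(y) ≥ max(μ, √y)`) nor in Beaton 2014 (eq. (16):
  `μ(y)` = the unfolded-walk rate); it is provisional on HTW82 §2–3, not held by the lane at the time of writing.
* THE REMAINING CLAUSES OF PROPOSITION 5: `μ(y) ≥ max(μ, √y)` (`max_le_surfaceMu`), non-decreasing (`surfaceMu_mono`),
  `μ(y') ≤ (y'/y) μ(y)` (`surfaceMu_le_div_mul`), continuous on `(0, ∞)` (`continuousOn_surfaceMu`), log-convex
  (`surfaceMu_sqrt_mul_sq_le : μ(√(y₁y₂))² ≤ μ(y₁) μ(y₂)`, by Cauchy–Schwarz on `C_n`), almost everywhere differentiable on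
  `(0, ∞)` (`ae_differentiableAt_surfaceMu`, Lebesgue's theorem `MonotoneOn.ae_differentiableWithinAt_of_mem`).
* THE RADIUS: `Σ_n C_n(y) xⁿ` converges for `x·μ(y) < 1` and its terms do not tend to `0` for `x·μ(y) > 1`
  (`summable_hpCoeff_mul_pow`, `not_summable_hpCoeff_mul_pow`); in T4's radius form,
  `halfPlaneBounded_iff_mul_surfaceMu_lt_one : x·μ(y) ≠ 1 → (HalfPlaneBounded x y ↔ x·μ(y) < 1)`.

Sources. J. M. Hammersley, G. M. Torrie, S. G. Whittington, J. Phys. A 15 (1982) 539–571, §2; N. R. Beaton, M. Bousquet-Mélou,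
J. de Gier, H. Duminil-Copin, A. J. Guttmann, CMP 326 (2014) 727–754, §3.1, Proposition 5 (arXiv:1109.0358v5 p. 9: statement,
proof by reference, Fig. 7); N. R. Beaton, J. Phys. A 47 (2014) 075003, Prop. 7 and eqs. (16)–(19) (arXiv:1210.0274v3 pp. 11–14:
the rotated-honeycomb adaptation of the unfolding); H. Duminil-Copin, S. Smirnov, Ann. Math. 175 (2012) 1653–1665, §3 (the
domains `S_{T,L}`, Fig. 3); N. Madras, G. Slade, The Self-Avoiding Walk (1993), §1.2 (Fekete, bridges).
-/

noncomputable section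

open Finset Filter Function
open Literature.Probability.LatticeModels Literature.Probability.Percolation SimpleGraph
open _root_.Topology

namespace Literature.Probability.RandomPlanarGeometry.SAW.HV

open Literature.Probability.RandomPlanarGeometry.SAW.HexBW.Wall

/-! ### The surface-aligned brick-wall chart -/

/-- **The chart** `(a, b, t) ↦ (2a + b + [t], -b)` of the DCS coordinates onto the brick wall, surface row to `Y = 0`.
[cite: DuminilCopinSmirnov2012, §3 (Fig. 3: the levels); BeatonBousquetMelouDeGierDuminilCopinGuttmann2014, §3.1 (arXiv v5 p. 8: half-plane walks and surface contacts)] -/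
def ch (v : HV) : Site 2 := ![2 * v.1 + v.2.1 + bit v, -v.2.1]

/-- First coordinate of the chart.
[cite: EntingJensen2009, §7.4.2, Fig. 7.10 (brickwork form of the honeycomb lattice); DuminilCopinSmirnov2012, §3 (Fig. 3); lane plumbing, not in print] -/
@[simp] theorem ch_apply_zero (v : HV) : ch v 0 = 2 * v.1 + v.2.1 + bit v := rfl
/-- Second coordinate of the chart.
[cite: EntingJensen2009, §7.4.2, Fig. 7.10 (brickwork form of the honeycomb lattice); DuminilCopinSmirnov2012, §3 (Fig. 3); lane plumbing, not in print] -/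
@[simp] theorem ch_apply_one (v : HV) : ch v 1 = -v.2.1 := rfl

/-- The inverse chart.
[cite: EntingJensen2009, §7.4.2, Fig. 7.10 (brickwork form of the honeycomb lattice); DuminilCopinSmirnov2012, §3 (Fig. 3); lane plumbing, not in print] -/
def chInv (x : Site 2) : HV :=
  if (x 0 + x 1) % 2 = 0 then ((x 0 + x 1) / 2, -x 1, false) else ((x 0 + x 1 - 1) / 2, -x 1, true)

/-- `chInv ∘ ch = id`.
[cite: EntingJensen2009, §7.4.2, Fig. 7.10 (brickwork form of the honeycomb lattice); DuminilCopinSmirnov2012, §3 (Fig. 3); lane plumbing, not in print] -/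
theorem chInv_ch (v : HV) : chInv (ch v) = v := by
  obtain ⟨a, b, c⟩ := v
  unfold chInv
  cases c <;> split_ifs with h <;>
    simp only [ch_apply_zero, ch_apply_one, bit_false, bit_true, Prod.mk.injEq, Bool.true_eq_false,
      Bool.false_eq_true, and_false, and_true] at h ⊢ <;> omega

/-- `ch ∘ chInv = id`.
[cite: EntingJensen2009, §7.4.2, Fig. 7.10 (brickwork form of the honeycomb lattice); DuminilCopinSmirnov2012, §3 (Fig. 3); lane plumbing, not in print] -/
theorem ch_chInv (x : Site 2) : ch (chInv x) = x := by
  rw [site_two_eq_iff, ch_apply_zero, ch_apply_one]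
  unfold chInv
  split_ifs with h
  · simp; omega
  · simp; omega

/-- The chart carries the honeycomb adjacency onto the brick-wall adjacency.
[cite: EntingJensen2009, §7.4.2, Fig. 7.10 (brickwork form of the honeycomb lattice); DuminilCopinSmirnov2012, §3 (Fig. 3); lane plumbing, not in print] -/
theorem adj_ch_iff (u v : HV) : brickWallGraph.Adj (ch u) (ch v) ↔ hvGraph.Adj u v := by
  rw [brickWallGraph_adj_coord, hvGraph_adj, HV.AdjRel]
  obtain ⟨a, b, c⟩ := u
  obtain ⟨a', b', c'⟩ := v
  cases c <;> cases c' <;> simp <;> omega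

/-- The chart as a graph isomorphism `ℍ ≃g brick wall`.
[cite: EntingJensen2009, §7.4.2, Fig. 7.10 (brickwork form of the honeycomb lattice); DuminilCopinSmirnov2012, §3 (Fig. 3); lane plumbing, not in print] -/
def chIso : hvGraph ≃g brickWallGraph where
  toFun := ch
  invFun := chInv
  left_inv := chInv_ch
  right_inv := ch_chInv
  map_rel_iff' := adj_ch_iff _ _

/-- The isomorphism is the chart.
[cite: EntingJensen2009, §7.4.2, Fig. 7.10 (brickwork form of the honeycomb lattice); DuminilCopinSmirnov2012, §3 (Fig. 3); lane plumbing, not in print] -/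
theorem coe_chIso : ⇑chIso = ch := rfl

/-- The chart is injective.
[cite: EntingJensen2009, §7.4.2, Fig. 7.10 (brickwork form of the honeycomb lattice); DuminilCopinSmirnov2012, §3 (Fig. 3); lane plumbing, not in print] -/
theorem ch_injective : Function.Injective ch := fun u v h => by
  have := congrArg chInv h; rwa [chInv_ch, chInv_ch] at this

/-- `ch O = 0`. [cite: DuminilCopinSmirnov2012, §3 (Fig. 3)] -/
theorem ch_hvOrigin : ch hvOrigin = 0 := by
  rw [site_two_eq_iff]; simp [hvOrigin]

/-- The surface row in the chart: `lev v = 0 ↔ Y = 0 ∧ X even`. [cite: DuminilCopinSmirnov2012, §3 (Fig. 3: the levels)] -/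
theorem lev_eq_zero_iff_ch (v : HV) : lev v = 0 ↔ ch v 1 = 0 ∧ ch v 0 % 2 = 0 := by
  obtain ⟨a, b, c⟩ := v; cases c <;> simp <;> omega

/-- Every honeycomb vertex has exactly three neighbours.
[cite: DuminilCopinSmirnov2012, §1 (the hexagonal lattice: every vertex has three neighbours); lane plumbing, not in print] -/
theorem length_nbrs (v : HV) : (HV.nbrs v).length = 3 := by
  obtain ⟨a, b, c⟩ := v; cases c <;> rfl

/-- A neighbour of `v` different from `p`.
[cite: DuminilCopinSmirnov2012, §1 (the hexagonal lattice: every vertex has three neighbours); lane plumbing, not in print] -/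
def otherNbr (v p : HV) : HV :=
  match v with
  | (a, b, false) => if p = (a, b, true) then (a - 1, b, true) else (a, b, true)
  | (a, b, true) => if p = (a, b, false) then (a + 1, b, false) else (a, b, false)

/-- `otherNbr v p` is adjacent to `v`.
[cite: DuminilCopinSmirnov2012, §1 (the hexagonal lattice: every vertex has three neighbours); lane plumbing, not in print] -/
theorem adj_otherNbr (v p : HV) : hvGraph.Adj v (otherNbr v p) := by
  rw [hvGraph_adj, HV.AdjRel]
  obtain ⟨a, b, c⟩ := v
  cases c <;> simp only [otherNbr] <;> split_ifs <;> simp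

/-- `otherNbr v p ≠ p`. [cite: DuminilCopinSmirnov2012, §1 (the hexagonal lattice: every vertex has three neighbours); lane plumbing, not in print] -/
theorem otherNbr_ne (v p : HV) : otherNbr v p ≠ p := by
  obtain ⟨a, b, c⟩ := v
  cases c <;> simp only [otherNbr] <;> split_ifs with h
  · rw [h]; intro e; have e1 := congrArg Prod.fst e; dsimp only at e1; omega
  · exact fun e => h e.symm
  · rw [h]; intro e; have e1 := congrArg Prod.fst e; dsimp only at e1; omega
  · exact fun e => h e.symm

/-! ### Vertex lists of `ℍ` as wall walks -/

section Dictionary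

variable {m : ℕ} {l : List HV} {y : ℝ}

/-- The brick-wall walk (`m` steps, function model) of an `(m+1)`-vertex list of `ℍ`. [cite: MadrasSlade1993, §1.1] -/
def bwOf (m : ℕ) (l : List HV) : ℕ → Site 2 := HexBW.ofList m (l.map ch)

/-- Self-avoiding lists from `O` go to self-avoiding brick-wall lists from `0`. [cite: MadrasSlade1993, §1.1] -/
theorem map_ch_mem_sawLists (h : l ∈ sawLists hvGraph hvOrigin m) :
    l.map ch ∈ sawLists brickWallGraph (0 : Site 2) m := by
  have h' := (map_mem_sawLists_iff chIso (v := hvOrigin) (n := m) (l := l)).2 h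
  rwa [coe_chIso, ch_hvOrigin] at h'

/-- … hence to brick-wall walks of the function model. [cite: MadrasSlade1993, §1.1] -/
theorem bwOf_mem_saws (h : l ∈ sawLists hvGraph hvOrigin m) : bwOf m l ∈ HexBW.saws m := by
  have := Set.mem_image_of_mem (HexBW.ofList m) (map_ch_mem_sawLists h)
  rw [HexBW.ofList_image] at this
  exact Finset.mem_coe.1 this

/-- The wall walk at time `i ≤ m` is the chart of the `i`-th vertex. [cite: MadrasSlade1993, §1.1] -/
theorem bwOf_apply (hl : l.length = m + 1) {i : ℕ} (hi : i ≤ m) : bwOf m l i = ch (l[i]'(by omega)) := by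
  unfold bwOf HexBW.ofList
  rw [min_eq_left hi, List.getD_eq_getElem _ _ (by rw [List.length_map]; omega), List.getElem_map]

/-- `1 + visits` counts the times `0 ≤ i ≤ m` with `i` even and `Y_i = 0`.
[cite: BeatonBousquetMelouDeGierDuminilCopinGuttmann2014, §3.1 (arXiv v5 p. 8: contacts of a walk with the surface); lane plumbing, not in print] -/
theorem visits_succ_eq_countP {ω : ℕ → Site 2} (h0 : ω 0 1 = 0) (m : ℕ) :
    visits m ω + 1 = (List.range (m + 1)).countP (fun i => decide (i % 2 = 0 ∧ ω i 1 = 0)) := by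
  induction m with
  | zero =>
    rw [visits_zero, show List.range (0 + 1) = [0] from rfl, List.countP_singleton]
    simp [h0]
  | succ m ih =>
    rw [show List.range (m + 1 + 1) = List.range (m + 1) ++ [m + 1] from List.range_succ, List.countP_append,
      List.countP_singleton, ← ih, visits_succ]
    simp only [decide_eq_true_eq]
    split_ifs <;> omega

/-- A list is the map of its entries over `range`.
[cite: MadrasSlade1993, §1.1 (walks as finite sequences of sites); lane plumbing (a list lemma), not in print] -/
theorem map_getD_range_eq {α : Type*} (l : List α) (d : α) :
    (List.range l.length).map (fun i => l.getD i d) = l :=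
  List.ext_getElem (by simp) fun i h1 h2 => by
    rw [List.getElem_map, List.getElem_range, List.getD_eq_getElem _ _ h2]

/-- Counting over a list is counting over its indices.
[cite: MadrasSlade1993, §1.1 (walks as finite sequences of sites); lane plumbing (a list lemma), not in print] -/
theorem countP_eq_countP_range {α : Type*} (l : List α) (d : α) (p : α → Bool) :
    l.countP p = (List.range l.length).countP (fun i => p (l.getD i d)) := by
  conv_lhs => rw [← map_getD_range_eq l d]
  rw [List.countP_map]; rfl

/-- **Surface vertices = `1 + visits`** for a self-avoiding list from `O` and its wall walk. [cite: BeatonBousquetMelouDeGierDuminilCopinGuttmann2014, §3.1 (arXiv v5 p. 8: "c(ω) denotes the number of contacts of ω with the surface")] -/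
theorem length_filter_lev_eq (h : l ∈ sawLists hvGraph hvOrigin m) :
    (l.filter fun v => lev v = 0).length = visits m (bwOf m l) + 1 := by
  have hlen : l.length = m + 1 := (mem_sawLists_iff.1 h).2.2.1
  have hω := bwOf_mem_saws h
  have h0 : bwOf m l 0 1 = 0 := by rw [(HexBW.mem_saws_iff.1 hω).1]; rfl
  rw [← List.countP_eq_length_filter, countP_eq_countP_range l hvOrigin, hlen, visits_succ_eq_countP h0 m]
  refine List.countP_congr fun i hi => ?_
  rw [List.mem_range] at hi
  have hpar := HexBW.parity_apply hω (show i ≤ m by omega)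
  have happ := bwOf_apply hlen (show i ≤ m by omega)
  simp only [decide_eq_true_eq]
  rw [List.getD_eq_getElem _ _ (by omega : i < l.length), lev_eq_zero_iff_ch, ← happ]
  constructor <;> rintro ⟨h1, h2⟩ <;> exact ⟨by omega, by omega⟩

/-! ### Mid-edge walks with `m + 1` visited vertices ↔ wall walks with `m` steps -/

/-- The index set of `C_{m+1}(y)`: mid-edge walks of `S_{m+1,m+1}` with `m + 1` visited vertices. [cite: BeatonBousquetMelouDeGierDuminilCopinGuttmann2014, §3.1 (arXiv v5 p. 8: `C_k^+(y)`)] -/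
def fib (m : ℕ) : Finset (List HV) := (midWalks (stripV (m + 1) (m + 1))).filter (fun P => mwLen P = m + 1)

/-- `C_{m+1}(y)` is the sum over `fib m`. [cite: BeatonBousquetMelouDeGierDuminilCopinGuttmann2014, §3.1 (arXiv v5 p. 8)] -/
theorem hpCoeff_succ_eq (m : ℕ) (y : ℝ) : hpCoeff (m + 1) y = ∑ P ∈ fib m, y ^ botContacts P := rfl

/-- **The wall walk of a mid-edge walk**: its inner vertex list in the chart. [cite: HammersleyTorrieWhittington1982, §2] -/
def toWall (m : ℕ) (P : List HV) : ℕ → Site 2 := bwOf m (inner P)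

/-- Anatomy of an element of `fib m`: `w :: (l ++ [u])` with `l` a self-avoiding `(m+1)`-list from `O` in the strip and `u ~ l.last`.
[cite: DuminilCopinSmirnov2012, §1] -/
theorem fib_anatomy {P : List HV} (hP : P ∈ fib m) :
    ∃ (l : List HV) (u : HV) (hl : l ≠ []), P = wOut :: (l ++ [u]) ∧ l ∈ sawLists hvGraph hvOrigin m ∧
      hvGraph.Adj (l.getLast hl) u ∧ ∀ x ∈ l, x ∈ stripV (m + 1) (m + 1) := by
  obtain ⟨hPm, hlen⟩ := mem_filter.1 hP
  have hmw := mem_midWalks_iff.1 hPm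
  rcases hmw.trivial_or_exists with rfl | ⟨l, u, hl, rfl⟩
  · rw [mwLen_trivial] at hlen; omega
  obtain ⟨hc, hh, hadj, hV, hnd, -⟩ := (isMidWalk_cons_append_iff _ hl u).1 hmw
  rw [mwLen_cons_append] at hlen
  exact ⟨l, u, hl, rfl, mem_sawLists_iff.2 ⟨hc, hh, by omega, hnd⟩, hadj, hV⟩

/-- The wall walk of an element of `fib m` is a half-plane walk. [cite: HammersleyTorrieWhittington1982, §2] -/
theorem toWall_mem_hpw {P : List HV} (hP : P ∈ fib m) : toWall m P ∈ hpw m := by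
  obtain ⟨l, u, hl, rfl, hsl, -, hV⟩ := fib_anatomy hP
  rw [toWall, inner_cons_append]
  refine mem_hpw.2 ⟨bwOf_mem_saws hsl, fun i hi => ?_⟩
  have hlen : l.length = m + 1 := (mem_sawLists_iff.1 hsl).2.2.1
  rw [bwOf_apply hlen hi, ch_apply_one, neg_nonpos]
  exact (mem_stripV_iff.1 (hV _ (List.getElem_mem _))).1

/-- **Contacts = `1 + visits`.** [cite: BeatonBousquetMelouDeGierDuminilCopinGuttmann2014, §3.1 (arXiv v5 p. 8)] -/
theorem botContacts_eq_visits {P : List HV} (hP : P ∈ fib m) : botContacts P = visits m (toWall m P) + 1 := by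
  obtain ⟨l, u, hl, rfl, hsl, -⟩ := fib_anatomy hP
  rw [botContacts, toWall, inner_cons_append]
  exact length_filter_lev_eq hsl

/-- **At most three-to-one**: the elements of `fib m` over a fixed wall walk differ only in the exit vertex, a neighbour of the
last visited vertex. [cite: HammersleyTorrieWhittington1982, §2] -/
theorem card_le_three_of_fibre {ω : ℕ → Site 2} (S : Finset (List HV)) (hS : ∀ P ∈ S, P ∈ fib m ∧ toWall m P = ω) :
    S.card ≤ 3 := by
  classical
  rcases S.eq_empty_or_nonempty with rfl | ⟨P₀, hP₀⟩
  · simp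
  obtain ⟨hP₀F, hω₀⟩ := hS P₀ hP₀
  obtain ⟨l₀, u₀, hl₀, rfl, hsl₀, -, -⟩ := fib_anatomy hP₀F
  rw [toWall, inner_cons_append] at hω₀
  have hsub : S ⊆ ((HV.nbrs (l₀.getLast hl₀)).toFinset).image (fun u => wOut :: (l₀ ++ [u])) := by
    intro P hP
    obtain ⟨hPF, hωP⟩ := hS P hP
    obtain ⟨l, u, hl, rfl, hsl, hadj, -⟩ := fib_anatomy hPF
    rw [toWall, inner_cons_append] at hωP
    have hll : l = l₀ :=
      (List.map_injective_iff.2 ch_injective)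
        (HexBW.ofList_injOn m (map_ch_mem_sawLists hsl) (map_ch_mem_sawLists hsl₀) (hωP.trans hω₀.symm))
    subst hll
    exact mem_image.2 ⟨u, List.mem_toFinset.2 ((hvGraph_adj_iff_mem_nbrs _ _).1 hadj), rfl⟩
  calc S.card ≤ (((HV.nbrs (l₀.getLast hl₀)).toFinset).image (fun u => wOut :: (l₀ ++ [u]))).card := card_le_card hsub
    _ ≤ (HV.nbrs (l₀.getLast hl₀)).toFinset.card := card_image_le
    _ ≤ (HV.nbrs (l₀.getLast hl₀)).length := List.toFinset_card_le _
    _ = 3 := length_nbrs _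

/-- **Onto**: every half-plane wall walk is the wall walk of an element of `fib m` (pull the vertices back by the chart and
exit through a neighbour of the last vertex other than the previous one; box exhaustion puts the walk in `S_{m+1,m+1}`).
[cite: HammersleyTorrieWhittington1982, §2; DuminilCopinSmirnov2012, §3 (S_{T,L})] -/
theorem fibre_nonempty {ω : ℕ → Site 2} (hω : ω ∈ hpw m) : ∃ P ∈ fib m, toWall m P = ω := by
  classical
  obtain ⟨hωs, hhp⟩ := mem_hpw.1 hω
  obtain ⟨l', hl', e⟩ : ω ∈ HexBW.ofList m '' sawLists brickWallGraph (0 : Site 2) m := by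
    rw [HexBW.ofList_image]; exact Finset.mem_coe.2 hωs
  set L := l'.map chInv with hL
  have hLmap : L.map ch = l' := by
    rw [hL, List.map_map, show ch ∘ chInv = id from funext ch_chInv, List.map_id]
  have hsL : L ∈ sawLists hvGraph hvOrigin m := by
    have h1 : L.map ⇑chIso ∈ sawLists brickWallGraph (chIso hvOrigin) m := by
      rw [coe_chIso, hLmap, ch_hvOrigin]; exact hl'
    exact (map_mem_sawLists_iff chIso).1 h1
  have hlen : L.length = m + 1 := (mem_sawLists_iff.1 hsL).2.2.1
  have hLne : L ≠ [] := List.ne_nil_of_length_pos (by omega)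
  have hbw : bwOf m L = ω := by rw [bwOf, hLmap, e]
  have hV0 : ∀ v ∈ L, 0 ≤ v.2.1 := by
    intro v hv
    obtain ⟨i, hi, rfl⟩ := List.getElem_of_mem hv
    have h := hhp i (by omega)
    rw [← hbw, bwOf_apply hlen (by omega), ch_apply_one] at h
    linarith
  set u := otherNbr (L.getLast hLne) (prevOf L)
  have hmw : IsMidWalk L.toFinset (wOut :: (L ++ [u])) :=
    (isMidWalk_cons_append_iff _ hLne u).2 ⟨(mem_sawLists_iff.1 hsL).1, (mem_sawLists_iff.1 hsL).2.1,
      adj_otherNbr _ _, fun x hx => List.mem_toFinset.2 hx, (mem_sawLists_iff.1 hsL).2.2.2, otherNbr_ne _ _⟩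
  have hbox := isMidWalk_box hmw (fun v hv => hV0 v (by rwa [inner_cons_append] at hv))
  rw [mwLen_cons_append, hlen] at hbox
  refine ⟨wOut :: (L ++ [u]), mem_filter.2 ⟨mem_midWalks_iff.2 hbox, by rw [mwLen_cons_append, hlen]⟩, ?_⟩
  rw [toWall, inner_cons_append, hbw]

/-- **Dictionary, upper half: `C_{m+1}(y) ≤ 3y · C^w_m(y)`** for `y ≥ 0`. [cite: HammersleyTorrieWhittington1982, §2; BeatonBousquetMelouDeGierDuminilCopinGuttmann2014, §3.1, Proposition 5 (arXiv v5 p. 9)] -/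
theorem hpCoeff_succ_le (m : ℕ) (hy : 0 ≤ y) : hpCoeff (m + 1) y ≤ 3 * y * Cw m y := by
  classical
  have hfw := Finset.sum_fiberwise_of_maps_to (s := fib m) (t := hpw m) (g := toWall m)
    (fun P hP => toWall_mem_hpw hP) (fun P => y ^ botContacts P)
  rw [hpCoeff_succ_eq, ← hfw, Cw, mul_sum]
  refine sum_le_sum fun ω _ => ?_
  have hinner : ∑ P ∈ (fib m).filter (fun P => toWall m P = ω), y ^ botContacts P
      = ∑ P ∈ (fib m).filter (fun P => toWall m P = ω), y ^ (visits m ω + 1) :=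
    sum_congr rfl fun P hP => by
      obtain ⟨hPF, hPω⟩ := mem_filter.1 hP
      rw [botContacts_eq_visits hPF, hPω]
  rw [hinner, sum_const, nsmul_eq_mul]
  have hcard := card_le_three_of_fibre (m := m) (ω := ω) ((fib m).filter (fun P => toWall m P = ω))
    (fun P hP => mem_filter.1 hP)
  calc (((fib m).filter (fun P => toWall m P = ω)).card : ℝ) * y ^ (visits m ω + 1)
      ≤ 3 * y ^ (visits m ω + 1) := mul_le_mul_of_nonneg_right (by exact_mod_cast hcard) (pow_nonneg hy _)
    _ = 3 * y * y ^ visits m ω := by rw [pow_succ]; ring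

/-- **Dictionary, lower half: `y · C^w_m(y) ≤ C_{m+1}(y)`** for `y ≥ 0`. [cite: HammersleyTorrieWhittington1982, §2; BeatonBousquetMelouDeGierDuminilCopinGuttmann2014, §3.1, Proposition 5 (arXiv v5 p. 9)] -/
theorem mul_Cw_le_hpCoeff_succ (m : ℕ) (hy : 0 ≤ y) : y * Cw m y ≤ hpCoeff (m + 1) y := by
  classical
  have hfw := Finset.sum_fiberwise_of_maps_to (s := fib m) (t := hpw m) (g := toWall m)
    (fun P hP => toWall_mem_hpw hP) (fun P => y ^ botContacts P)
  rw [hpCoeff_succ_eq, ← hfw, Cw, mul_sum]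
  refine sum_le_sum fun ω hω => ?_
  have hinner : ∑ P ∈ (fib m).filter (fun P => toWall m P = ω), y ^ botContacts P
      = ∑ P ∈ (fib m).filter (fun P => toWall m P = ω), y ^ (visits m ω + 1) :=
    sum_congr rfl fun P hP => by
      obtain ⟨hPF, hPω⟩ := mem_filter.1 hP
      rw [botContacts_eq_visits hPF, hPω]
  rw [hinner, sum_const, nsmul_eq_mul]
  obtain ⟨P, hPF, hPω⟩ := fibre_nonempty hω
  have h1 : (1 : ℝ) ≤ ((fib m).filter (fun P => toWall m P = ω)).card := by
    exact_mod_cast Finset.one_le_card.2 ⟨P, mem_filter.2 ⟨hPF, hPω⟩⟩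
  calc y * y ^ visits m ω = 1 * y ^ (visits m ω + 1) := by rw [pow_succ]; ring
    _ ≤ (((fib m).filter (fun P => toWall m P = ω)).card : ℝ) * y ^ (visits m ω + 1) :=
        mul_le_mul_of_nonneg_right h1 (pow_nonneg hy _)

end Dictionary

/-! ### The growth rate `μ(y) = max(β(y), μ)` and the limit -/

variable {y : ℝ}

/-- **`μ(y) := max(β(y), μ)`**, the growth rate of the half-plane partition function at surface fugacity `y` (that this IS the
limit is `tendsto_hpCoeff_rpow`; the closed form `max(β(y), μ)` is not printed in the cited sources — provisional on HTW82 §2–3).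
[cite: BeatonBousquetMelouDeGierDuminilCopinGuttmann2014, §3.1, Proposition 5 (arXiv v5 p. 9: "μ(y) := lim_{k→∞} C_k^+(y)^{1/k} exists and is finite")] -/
def surfaceMu (y : ℝ) : ℝ := max (wallRate y) hexConnectiveConstant

/-- `μ(y) > 0`. [cite: BeatonBousquetMelouDeGierDuminilCopinGuttmann2014, §3.1, Proposition 5 (arXiv v5 p. 9)] -/
theorem surfaceMu_pos (y : ℝ) : 0 < surfaceMu y := lt_max_of_lt_left (wallRate_pos y)

/-- `μ ≤ μ(y)`. [cite: BeatonBousquetMelouDeGierDuminilCopinGuttmann2014, §3.1, Proposition 5 (arXiv v5 p. 9: "μ(y) ≥ max(μ, √y)")] -/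
theorem hexConnectiveConstant_le_surfaceMu (y : ℝ) : hexConnectiveConstant ≤ surfaceMu y := le_max_right _ _

/-- `β(y) ≤ μ(y)`. [cite: HammersleyTorrieWhittington1982, §2] -/
theorem wallRate_le_surfaceMu (y : ℝ) : wallRate y ≤ surfaceMu y := le_max_left _ _

/-- **limsup half: for `r > μ(y)`, eventually `C_n(y) ≤ rⁿ`.** [cite: HammersleyTorrieWhittington1982, §2; BeatonBousquetMelouDeGierDuminilCopinGuttmann2014, §3.1, Proposition 5 (arXiv v5 p. 9)] -/
theorem eventually_hpCoeff_le_pow (hy : 0 < y) {r : ℝ} (hr : surfaceMu y < r) :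
    ∀ᶠ n : ℕ in atTop, hpCoeff n y ≤ r ^ n := by
  obtain ⟨r', hMr', hr'r⟩ := exists_between hr
  have hr'0 : 0 < r' := (surfaceMu_pos y).trans hMr'
  have hq : 1 < r / r' := (one_lt_div hr'0).2 hr'r
  have hev1 := eventually_Cw_le_pow hy hMr'
  have hev2 := (tendsto_pow_atTop_atTop_of_one_lt hq).eventually_ge_atTop (3 * y / r')
  have hev : ∀ᶠ m : ℕ in atTop, hpCoeff (m + 1) y ≤ r ^ (m + 1) := by
    filter_upwards [hev1, hev2] with m h1 h2
    have hr'm : 0 < r' ^ m := pow_pos hr'0 m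
    have h3 : 3 * y ≤ (r / r') ^ m * r' := (div_le_iff₀ hr'0).1 h2
    have hrr : (r / r') ^ m * r' ^ m = r ^ m := by rw [div_pow, div_mul_cancel₀ _ hr'm.ne']
    calc hpCoeff (m + 1) y ≤ 3 * y * Cw m y := hpCoeff_succ_le m hy.le
      _ ≤ 3 * y * r' ^ m := mul_le_mul_of_nonneg_left h1 (by positivity)
      _ ≤ ((r / r') ^ m * r') * r' ^ m := mul_le_mul_of_nonneg_right h3 hr'm.le
      _ = r ^ m * r' := by rw [mul_right_comm, hrr]
      _ ≤ r ^ m * r := mul_le_mul_of_nonneg_left hr'r.le (pow_nonneg (hr'0.le.trans hr'r.le) _)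
      _ = r ^ (m + 1) := (pow_succ r m).symm
  rw [Filter.eventually_atTop] at hev ⊢
  obtain ⟨N, hN⟩ := hev
  refine ⟨N + 1, fun n hn => ?_⟩
  obtain ⟨m, rfl⟩ : ∃ m, n = m + 1 := ⟨n - 1, by omega⟩
  exact hN m (by omega)

/-- **liminf half at `β(y)`: for `0 ≤ r < β(y)`, eventually `rⁿ ≤ C_n(y)`.** [cite: HammersleyTorrieWhittington1982, §2] -/
theorem growthGeRate_wallRate (hy : 0 < y) : GrowthGeRate y (wallRate y) := by
  intro r hr0 hr
  rcases hr0.eq_or_lt with rfl | hr0'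
  · refine Filter.eventually_atTop.2 ⟨1, fun n hn => ?_⟩
    rw [zero_pow (by omega)]
    exact hpCoeff_nonneg n hy.le
  obtain ⟨r₁, hrr₁, hr₁β⟩ := exists_between hr
  have hr₁0 : 0 < r₁ := hr0'.trans hrr₁
  set c := r₁ ^ 2 / y * min 1 r₁⁻¹ with hc
  have hc0 : 0 < c := mul_pos (div_pos (pow_pos hr₁0 2) hy) (lt_min one_pos (inv_pos.2 hr₁0))
  have hev1 := eventually_mul_pow_le_Cw hy hr₁0 hr₁β
  have hq : 1 < r₁ / r := (one_lt_div hr0').2 hrr₁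
  have hev2 := (tendsto_pow_atTop_atTop_of_one_lt hq).eventually_ge_atTop (r / (y * c))
  have hev : ∀ᶠ m : ℕ in atTop, r ^ (m + 1) ≤ hpCoeff (m + 1) y := by
    filter_upwards [hev1, hev2] with m h1 h2
    have h3 : r ≤ (r₁ / r) ^ m * (y * c) := (div_le_iff₀ (mul_pos hy hc0)).1 h2
    have hrr : (r₁ / r) ^ m * r ^ m = r₁ ^ m := by rw [div_pow, div_mul_cancel₀ _ (pow_pos hr0' m).ne']
    calc r ^ (m + 1) = r * r ^ m := pow_succ' r m
      _ ≤ ((r₁ / r) ^ m * (y * c)) * r ^ m := mul_le_mul_of_nonneg_right h3 (pow_nonneg hr0 _)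
      _ = y * (c * ((r₁ / r) ^ m * r ^ m)) := by ring
      _ = y * (c * r₁ ^ m) := by rw [hrr]
      _ ≤ y * Cw m y := mul_le_mul_of_nonneg_left h1 hy.le
      _ ≤ hpCoeff (m + 1) y := mul_Cw_le_hpCoeff_succ m hy.le
  rw [Filter.eventually_atTop] at hev ⊢
  obtain ⟨N, hN⟩ := hev
  refine ⟨N + 1, fun n hn => ?_⟩
  obtain ⟨m, rfl⟩ : ∃ m, n = m + 1 := ⟨n - 1, by omega⟩
  exact hN m (by omega)

/-- **liminf half at `μ(y)`**: Part I below `β(y)`, T5's `growthGeRate_mu_of_pos` below `μ`. [cite: HammersleyTorrieWhittington1982, §2; BeatonBousquetMelouDeGierDuminilCopinGuttmann2014, §3.1, Proposition 5 (arXiv v5 p. 9: "μ(y) ≥ max(μ, √y)")] -/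
theorem growthGeRate_surfaceMu (hy : 0 < y) : GrowthGeRate y (surfaceMu y) :=
  (growthGeRate_wallRate hy).max (growthGeRate_mu_of_pos hy)

/-- **BBdGDCG14 Proposition 5, first sentence, for the honeycomb lattice: for every `y > 0` the limit
`μ(y) = lim_n C_n^+(y)^{1/n}` EXISTS** (and equals `max(β(y), μ)`). [cite: BeatonBousquetMelouDeGierDuminilCopinGuttmann2014, §3.1, Proposition 5 (arXiv v5 p. 9: "For y > 0, μ(y) := lim_{k→∞} C_k^+(y)^{1/k} exists and is finite", proof: "[HTW82] … apply mutatis mutandis to the honeycomb lattice"); HammersleyTorrieWhittington1982, §2; Beaton2014RotatedHoneycomb, Proposition 7 (arXiv v3 p. 11, eq. (16))] -/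
theorem tendsto_hpCoeff_rpow (hy : 0 < y) :
    Tendsto (fun n : ℕ => hpCoeff n y ^ ((n : ℝ)⁻¹)) atTop (𝓝 (surfaceMu y)) := by
  have hM := surfaceMu_pos y
  have hge := growthGeRate_surfaceMu hy
  rw [tendsto_order]
  constructor
  · intro a ha
    set r := (max a 0 + surfaceMu y) / 2 with hr_def
    have hmax : max a 0 < surfaceMu y := max_lt ha hM
    have hr0 : 0 ≤ r := by rw [hr_def]; have := le_max_right a 0; linarith
    have har : a < r := by rw [hr_def]; have := le_max_left a 0; linarith
    have hrM : r < surfaceMu y := by rw [hr_def]; linarith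
    filter_upwards [hge r hr0 hrM, eventually_ne_atTop 0] with n hn hn0
    calc a < r := har
      _ = (r ^ n) ^ ((n : ℝ)⁻¹) := (Real.pow_rpow_inv_natCast hr0 hn0).symm
      _ ≤ hpCoeff n y ^ ((n : ℝ)⁻¹) := Real.rpow_le_rpow (pow_nonneg hr0 n) hn (inv_nonneg.2 (Nat.cast_nonneg n))
  · intro b hb
    set r := (b + surfaceMu y) / 2 with hr_def
    have hMr : surfaceMu y < r := by rw [hr_def]; linarith
    have hrb : r < b := by rw [hr_def]; linarith
    have hr0 : 0 ≤ r := hM.le.trans hMr.le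
    filter_upwards [eventually_hpCoeff_le_pow hy hMr, eventually_ne_atTop 0] with n hn hn0
    calc hpCoeff n y ^ ((n : ℝ)⁻¹) ≤ (r ^ n) ^ ((n : ℝ)⁻¹) :=
          Real.rpow_le_rpow (hpCoeff_nonneg n hy.le) hn (inv_nonneg.2 (Nat.cast_nonneg n))
      _ = r := Real.pow_rpow_inv_natCast hr0 hn0
      _ < b := hrb

/-- The limit exists (existential form). [cite: BeatonBousquetMelouDeGierDuminilCopinGuttmann2014, §3.1, Proposition 5 (arXiv v5 p. 9)] -/
theorem exists_tendsto_hpCoeff_rpow (hy : 0 < y) :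
    ∃ μy : ℝ, 0 < μy ∧ Tendsto (fun n : ℕ => hpCoeff n y ^ ((n : ℝ)⁻¹)) atTop (𝓝 μy) :=
  ⟨surfaceMu y, surfaceMu_pos y, tendsto_hpCoeff_rpow hy⟩

/-- **`μ(y) = μ` iff `y ≤ y_c = 1 + √2`.** [cite: BeatonBousquetMelouDeGierDuminilCopinGuttmann2014, Theorem 2 (arXiv v5 p. 3) with §3.1, Proposition 5 (p. 9: "μ(y) = μ if y ≤ y_c, > μ if y > y_c")] -/
theorem surfaceMu_eq_iff (hy : 0 < y) : surfaceMu y = hexConnectiveConstant ↔ y ≤ 1 + Real.sqrt 2 := by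
  rw [← tendsto_hpCoeff_rpow_iff hy]
  constructor
  · intro h; rw [← h]; exact tendsto_hpCoeff_rpow hy
  · intro h; exact tendsto_nhds_unique (tendsto_hpCoeff_rpow hy) h

/-- **`μ(y) > μ` iff `y > y_c`.** [cite: BeatonBousquetMelouDeGierDuminilCopinGuttmann2014, §3.1, Proposition 5 (arXiv v5 p. 9: "> μ if y > y_c")] -/
theorem hexConnectiveConstant_lt_surfaceMu_iff (hy : 0 < y) :
    hexConnectiveConstant < surfaceMu y ↔ 1 + Real.sqrt 2 < y := by
  rw [(hexConnectiveConstant_le_surfaceMu y).lt_iff_ne, ne_comm, Ne, surfaceMu_eq_iff hy, not_le]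

/-- **The wall-bridge rate exceeds `μ` exactly in the adsorbed phase: `β(y) > μ ↔ y > 1 + √2`.** [cite: HammersleyTorrieWhittington1982, §2; BeatonBousquetMelouDeGierDuminilCopinGuttmann2014, §3.1, Proposition 5 (arXiv v5 p. 9)] -/
theorem hexConnectiveConstant_lt_wallRate_iff (hy : 0 < y) :
    hexConnectiveConstant < wallRate y ↔ 1 + Real.sqrt 2 < y := by
  rw [← hexConnectiveConstant_lt_surfaceMu_iff hy, surfaceMu, lt_max_iff, or_iff_left (lt_irrefl _)]

/-- In the adsorbed phase the limit is the wall-bridge rate: `μ(y) = β(y)` for `y > 1 + √2`. [cite: HammersleyTorrieWhittington1982, §2; BeatonBousquetMelouDeGierDuminilCopinGuttmann2014, §3.1, Proposition 5 (arXiv v5 p. 9)] -/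
theorem surfaceMu_eq_wallRate (hy : 0 < y) (h : 1 + Real.sqrt 2 < y) : surfaceMu y = wallRate y :=
  max_eq_left ((hexConnectiveConstant_lt_wallRate_iff hy).2 h).le


/-! ### Properties of `μ(y)`: `μ(y) ≥ max(μ, √y)`, monotone, `μ(y)/y` non-increasing, continuous, log-convex -/

/-- Any eventual lower rate is below the limit: `GrowthGeRate y ρ → ρ ≤ μ(y)`. [cite: BeatonBousquetMelouDeGierDuminilCopinGuttmann2014, §3.1, Proposition 5 (arXiv v5 p. 9)] -/
theorem le_surfaceMu_of_growthGeRate (hy : 0 < y) {ρ : ℝ} (h : GrowthGeRate y ρ) : ρ ≤ surfaceMu y := by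
  refine le_of_forall_lt_imp_le_of_dense fun r hr => ?_
  rcases lt_or_ge r 0 with hr0 | hr0
  · exact hr0.le.trans (surfaceMu_pos y).le
  refine ge_of_tendsto (tendsto_hpCoeff_rpow hy) ?_
  filter_upwards [h r hr0 hr, eventually_ne_atTop 0] with n hn hn0
  calc r = (r ^ n) ^ ((n : ℝ)⁻¹) := (Real.pow_rpow_inv_natCast hr0 hn0).symm
    _ ≤ hpCoeff n y ^ ((n : ℝ)⁻¹) := Real.rpow_le_rpow (pow_nonneg hr0 n) hn (inv_nonneg.2 (Nat.cast_nonneg n))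

/-- **`μ(y) ≥ √y`** (the surface zig-zag, T5's `growthGeRate_sqrt`). [cite: BeatonBousquetMelouDeGierDuminilCopinGuttmann2014, §3.1, Proposition 5 (arXiv v5 p. 9: "μ(y) ≥ max(μ, √y)")] -/
theorem sqrt_le_surfaceMu (hy : 0 < y) : Real.sqrt y ≤ surfaceMu y :=
  le_surfaceMu_of_growthGeRate hy (growthGeRate_sqrt hy)

/-- **`μ(y) ≥ max(μ, √y)`.** [cite: BeatonBousquetMelouDeGierDuminilCopinGuttmann2014, §3.1, Proposition 5 (arXiv v5 p. 9: "μ(y) ≥ max(μ, √y)")] -/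
theorem max_le_surfaceMu (hy : 0 < y) : max hexConnectiveConstant (Real.sqrt y) ≤ surfaceMu y :=
  max_le (hexConnectiveConstant_le_surfaceMu y) (sqrt_le_surfaceMu hy)

/-- **`μ(y)` is non-decreasing in `y`.** [cite: BeatonBousquetMelouDeGierDuminilCopinGuttmann2014, §3.1, Proposition 5 (arXiv v5 p. 9: "a … non-decreasing function of y"); HammersleyTorrieWhittington1982, §2] -/
theorem surfaceMu_mono (hy : 0 < y) {y' : ℝ} (hyy' : y ≤ y') : surfaceMu y ≤ surfaceMu y' :=
  le_of_tendsto_of_tendsto' (tendsto_hpCoeff_rpow hy) (tendsto_hpCoeff_rpow (hy.trans_le hyy')) fun n =>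
    Real.rpow_le_rpow (hpCoeff_nonneg n hy.le) (hpCoeff_mono n hy.le hyy') (inv_nonneg.2 (Nat.cast_nonneg n))

/-- **`μ(y') ≤ (y'/y) μ(y)` for `0 < y ≤ y'`** — `μ(y)/y` is non-increasing (from `C_n(y') ≤ (y'/y)ⁿ C_n(y)`, T4's `hpCoeff_le_pow_mul`).
[cite: HammersleyTorrieWhittington1982, §2; BeatonBousquetMelouDeGierDuminilCopinGuttmann2014, §3.1, Proposition 5 (arXiv v5 p. 9)] -/
theorem surfaceMu_le_div_mul (hy : 0 < y) {y' : ℝ} (hyy' : y ≤ y') : surfaceMu y' ≤ y' / y * surfaceMu y := by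
  have hq : 0 ≤ y' / y := div_nonneg (hy.le.trans hyy') hy.le
  refine le_of_tendsto_of_tendsto (tendsto_hpCoeff_rpow (hy.trans_le hyy')) ((tendsto_hpCoeff_rpow hy).const_mul _) ?_
  filter_upwards [eventually_ne_atTop 0] with n hn0
  calc hpCoeff n y' ^ ((n : ℝ)⁻¹) ≤ ((y' / y) ^ n * hpCoeff n y) ^ ((n : ℝ)⁻¹) :=
        Real.rpow_le_rpow (hpCoeff_nonneg n (hy.le.trans hyy')) (hpCoeff_le_pow_mul hy hyy' n)
          (inv_nonneg.2 (Nat.cast_nonneg n))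
    _ = y' / y * hpCoeff n y ^ ((n : ℝ)⁻¹) := by
        rw [Real.mul_rpow (pow_nonneg hq n) (hpCoeff_nonneg n hy.le), Real.pow_rpow_inv_natCast hq hn0]

/-- **`μ(y)` is continuous on `(0, ∞)`** (monotone with `μ(y)/y` non-increasing). [cite: BeatonBousquetMelouDeGierDuminilCopinGuttmann2014, §3.1, Proposition 5 (arXiv v5 p. 9: "a continuous … function of y"); HammersleyTorrieWhittington1982, §2] -/
theorem continuousOn_surfaceMu : ContinuousOn surfaceMu (Set.Ioi 0) := by
  rw [Metric.continuousOn_iff]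
  intro y₀ hy₀ ε hε
  have hy₀' : (0 : ℝ) < y₀ := hy₀
  have hM : 0 < surfaceMu y₀ := surfaceMu_pos y₀
  set M := surfaceMu y₀ with hMdef
  have hy0ne : y₀ ≠ 0 := hy₀'.ne'
  have hMne : M ≠ 0 := hM.ne'
  refine ⟨min (y₀ / 2) (ε * y₀ / (4 * M)), lt_min (by linarith) (by positivity), fun y hy hd => ?_⟩
  have hy' : (0 : ℝ) < y := hy
  have hyne : y ≠ 0 := hy'.ne'
  rw [Real.dist_eq] at hd ⊢
  have hd1 : |y - y₀| < y₀ / 2 := lt_of_lt_of_le hd (min_le_left _ _)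
  have hd2 : |y - y₀| < ε * y₀ / (4 * M) := lt_of_lt_of_le hd (min_le_right _ _)
  rw [abs_sub_lt_iff] at hd1 hd2 ⊢
  rcases le_or_gt y₀ y with hle | hlt
  · have h1 := surfaceMu_mono hy₀' hle
    have h2 := surfaceMu_le_div_mul hy₀' hle
    have e : y / y₀ * M - M = (y - y₀) / y₀ * M := by rw [sub_div, div_self hy0ne]; ring
    constructor
    · calc surfaceMu y - M ≤ (y - y₀) / y₀ * M := by linarith [h2, e]
        _ ≤ (ε * y₀ / (4 * M)) / y₀ * M :=
            mul_le_mul_of_nonneg_right (div_le_div_of_nonneg_right hd2.1.le hy₀'.le) hM.le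
        _ = ε / 4 := by field_simp
        _ < ε := by linarith
    · linarith [h1]
  · have hle := hlt.le
    have h1 := surfaceMu_mono hy' hle
    have h2 := surfaceMu_le_div_mul hy' hle
    have hy2 : y₀ / 2 < y := by linarith [hd1.2]
    have e : y₀ / y * surfaceMu y - surfaceMu y = (y₀ - y) / y * surfaceMu y := by rw [sub_div, div_self hyne]; ring
    constructor
    · linarith [h1]
    · have h3 : M - surfaceMu y ≤ (y₀ - y) / y * surfaceMu y := by linarith [h2, e]
      have h4 : (y₀ - y) / y * surfaceMu y ≤ (y₀ - y) / y * M :=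
        mul_le_mul_of_nonneg_left h1 (div_nonneg (by linarith) hy'.le)
      have h5 : (y₀ - y) / y < ε / (2 * M) := by
        rw [div_lt_iff₀ hy']
        calc y₀ - y < ε * y₀ / (4 * M) := hd2.2
          _ = ε / (2 * M) * (y₀ / 2) := by field_simp; ring
          _ < ε / (2 * M) * y := mul_lt_mul_of_pos_left hy2 (by positivity)
      calc M - surfaceMu y ≤ (y₀ - y) / y * M := h3.trans h4
        _ < ε / (2 * M) * M := mul_lt_mul_of_pos_right h5 hM
        _ = ε / 2 := by field_simp
        _ < ε := by linarith

/-- Cauchy–Schwarz on the fibre: **`C_n(√(y₁y₂))² ≤ C_n(y₁)·C_n(y₂)`.** [cite: HammersleyTorrieWhittington1982, §2] -/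
theorem hpCoeff_sqrt_mul_sq_le {y₁ y₂ : ℝ} (hy₁ : 0 ≤ y₁) (hy₂ : 0 ≤ y₂) (n : ℕ) :
    hpCoeff n (Real.sqrt (y₁ * y₂)) ^ 2 ≤ hpCoeff n y₁ * hpCoeff n y₂ := by
  have key := Finset.sum_mul_sq_le_sq_mul_sq ((midWalks (stripV n n)).filter (fun P => mwLen P = n))
    (fun P => Real.sqrt y₁ ^ botContacts P) (fun P => Real.sqrt y₂ ^ botContacts P)
  have e : ∀ P : List HV, Real.sqrt (y₁ * y₂) ^ botContacts P = Real.sqrt y₁ ^ botContacts P * Real.sqrt y₂ ^ botContacts P :=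
    fun P => by rw [Real.sqrt_mul hy₁, mul_pow]
  have e1 : ∀ P : List HV, (Real.sqrt y₁ ^ botContacts P) ^ 2 = y₁ ^ botContacts P :=
    fun P => by rw [← pow_mul, mul_comm, pow_mul, Real.sq_sqrt hy₁]
  have e2 : ∀ P : List HV, (Real.sqrt y₂ ^ botContacts P) ^ 2 = y₂ ^ botContacts P :=
    fun P => by rw [← pow_mul, mul_comm, pow_mul, Real.sq_sqrt hy₂]
  simp only [e1, e2] at key
  unfold hpCoeff
  simp only [e]
  exact key

/-- **Log-convexity: `μ(√(y₁y₂))² ≤ μ(y₁)·μ(y₂)`** — `log μ(y)` is a convex function of `log y`.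
[cite: HammersleyTorrieWhittington1982, §2; BeatonBousquetMelouDeGierDuminilCopinGuttmann2014, §3.1, Proposition 5 (arXiv v5 p. 9)] -/
theorem surfaceMu_sqrt_mul_sq_le {y₁ y₂ : ℝ} (hy₁ : 0 < y₁) (hy₂ : 0 < y₂) :
    surfaceMu (Real.sqrt (y₁ * y₂)) ^ 2 ≤ surfaceMu y₁ * surfaceMu y₂ := by
  have hs : 0 < Real.sqrt (y₁ * y₂) := Real.sqrt_pos.2 (mul_pos hy₁ hy₂)
  refine le_of_tendsto_of_tendsto' ((tendsto_hpCoeff_rpow hs).pow 2)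
    ((tendsto_hpCoeff_rpow hy₁).mul (tendsto_hpCoeff_rpow hy₂)) fun n => ?_
  have h0 := hpCoeff_nonneg n hs.le
  calc (hpCoeff n (Real.sqrt (y₁ * y₂)) ^ ((n : ℝ)⁻¹)) ^ 2 = (hpCoeff n (Real.sqrt (y₁ * y₂)) ^ 2) ^ ((n : ℝ)⁻¹) :=
        Real.rpow_pow_comm h0 _ 2
    _ ≤ (hpCoeff n y₁ * hpCoeff n y₂) ^ ((n : ℝ)⁻¹) :=
        Real.rpow_le_rpow (sq_nonneg _) (hpCoeff_sqrt_mul_sq_le hy₁.le hy₂.le n) (inv_nonneg.2 (Nat.cast_nonneg n))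
    _ = hpCoeff n y₁ ^ ((n : ℝ)⁻¹) * hpCoeff n y₂ ^ ((n : ℝ)⁻¹) :=
        Real.mul_rpow (hpCoeff_nonneg n hy₁.le) (hpCoeff_nonneg n hy₂.le)

/-- `μ(y)` is monotone on `(0, ∞)`. [cite: BeatonBousquetMelouDeGierDuminilCopinGuttmann2014, §3.1, Proposition 5 (arXiv v5 p. 9)] -/
theorem monotoneOn_surfaceMu : MonotoneOn surfaceMu (Set.Ioi 0) :=
  fun _ hy _ _ hyy' => surfaceMu_mono hy hyy'

/-- **`μ(y)` is almost everywhere differentiable on `(0, ∞)`** (Lebesgue's theorem for the monotone function `μ`).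
[cite: BeatonBousquetMelouDeGierDuminilCopinGuttmann2014, §3.1, Proposition 5 (arXiv v5 p. 9: "and therefore continuous and almost everywhere differentiable")] -/
theorem ae_differentiableAt_surfaceMu : ∀ᵐ y : ℝ, 0 < y → DifferentiableAt ℝ surfaceMu y :=
  (monotoneOn_surfaceMu.ae_differentiableWithinAt_of_mem).mono fun _ h hy => (h hy).differentiableAt (Ioi_mem_nhds hy)

/-! ### The radius of convergence of `C⁺(x, y) = Σ_n C_n(y) xⁿ` is `ρ(y) = 1/μ(y)` -/

/-- Inner side of the radius: **`x·μ(y) < 1 ⇒ Σ_n C_n(y) xⁿ < ∞`.**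
[cite: BeatonBousquetMelouDeGierDuminilCopinGuttmann2014, §3.1 (arXiv v5 p. 10: "Recall that (1/k) log C_k^+(y) tends to log μ(y)"; Proposition 5 p. 9)] -/
theorem summable_hpCoeff_mul_pow (hy : 0 < y) {x : ℝ} (hx : 0 ≤ x) (h : x * surfaceMu y < 1) :
    Summable fun n => hpCoeff n y * x ^ n := by
  rcases hx.eq_or_lt with rfl | hx0
  · refine summable_of_ne_finset_zero (s := {0}) fun n hn => ?_
    rw [Finset.mem_singleton] at hn
    simp [zero_pow hn]
  obtain ⟨q, hq1, hq2⟩ := exists_between h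
  have hq0 : 0 < q := (mul_pos hx0 (surfaceMu_pos y)).trans hq1
  have hμr : surfaceMu y < q / x := by rwa [lt_div_iff₀ hx0, mul_comm]
  refine Summable.of_norm_bounded_eventually_nat (summable_geometric_of_lt_one hq0.le hq2) ?_
  filter_upwards [eventually_hpCoeff_le_pow hy hμr] with n hn
  rw [Real.norm_of_nonneg (mul_nonneg (hpCoeff_nonneg n hy.le) (pow_nonneg hx n))]
  calc hpCoeff n y * x ^ n ≤ (q / x) ^ n * x ^ n := mul_le_mul_of_nonneg_right hn (pow_nonneg hx n)
    _ = q ^ n := by rw [← mul_pow, div_mul_cancel₀ q hx0.ne']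

/-- Outer side of the radius: **`x·μ(y) > 1 ⇒ Σ_n C_n(y) xⁿ = ∞`** (the terms do not even tend to `0`).
[cite: BeatonBousquetMelouDeGierDuminilCopinGuttmann2014, §3.1 (arXiv v5 p. 10: "Recall that (1/k) log C_k^+(y) tends to log μ(y)"; Proposition 5 p. 9)] -/
theorem not_summable_hpCoeff_mul_pow (hy : 0 < y) {x : ℝ} (hx : 0 ≤ x) (h : 1 < x * surfaceMu y) :
    ¬ Summable fun n => hpCoeff n y * x ^ n := by
  intro hs
  have hx0 : 0 < x := by
    rcases hx.eq_or_lt with rfl | hx0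
    · norm_num at h
    · exact hx0
  obtain ⟨q, hq1, hq2⟩ := exists_between h
  have hr : q / x < surfaceMu y := by rwa [div_lt_iff₀ hx0, mul_comm]
  have hq0 : (0 : ℝ) ≤ q / x := div_nonneg (zero_le_one.trans hq1.le) hx
  have h1 : ∀ᶠ n : ℕ in atTop, (1 : ℝ) ≤ hpCoeff n y * x ^ n := by
    filter_upwards [growthGeRate_surfaceMu hy (q / x) hq0 hr] with n hn
    calc (1 : ℝ) ≤ q ^ n := one_le_pow₀ hq1.le
      _ = (q / x) ^ n * x ^ n := by rw [← mul_pow, div_mul_cancel₀ q hx0.ne']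
      _ ≤ hpCoeff n y * x ^ n := mul_le_mul_of_nonneg_right hn (pow_nonneg hx n)
  have h2 : ∀ᶠ n : ℕ in atTop, hpCoeff n y * x ^ n < 1 := hs.tendsto_atTop_zero.eventually (gt_mem_nhds one_pos)
  obtain ⟨n, hn1, hn2⟩ := (h1.and h2).exists
  exact absurd hn2 (not_lt.2 hn1)

/-- **`ρ(y) = 1/μ(y)` is the radius of convergence of the half-plane generating function** in the tree's radius form
`HalfPlaneBounded` (T4's `halfPlaneBounded_iff_summable`): off the circle `x·μ(y) = 1`, `HalfPlaneBounded x y ↔ x·μ(y) < 1`.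
[cite: BeatonBousquetMelouDeGierDuminilCopinGuttmann2014, §3.1, Proposition 5 (arXiv v5 p. 9) and p. 10 ("Recall that (1/k) log C_k^+(y) tends to log μ(y)"); GlazmanManolescu2019, Definition 1.1 (arXiv v3 p. 5: the sup-radius form)] -/
theorem halfPlaneBounded_iff_mul_surfaceMu_lt_one (hy : 0 < y) {x : ℝ} (hx : 0 ≤ x) (hne : x * surfaceMu y ≠ 1) :
    HalfPlaneBounded x y ↔ x * surfaceMu y < 1 := by
  rw [halfPlaneBounded_iff_summable hx hy.le]
  rcases lt_or_gt_of_ne hne with h | h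
  · exact ⟨fun _ => h, fun _ => summable_hpCoeff_mul_pow hy hx h⟩
  · exact ⟨fun hs => absurd hs (not_summable_hpCoeff_mul_pow hy hx h), fun h' => absurd (h.trans h') (lt_irrefl _)⟩

end Literature.Probability.RandomPlanarGeometry.SAW.HV
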